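import Mathlib.Analysis.Complex.Basic
import Mathlib.LinearAlgebra.Matrix.Determinant.Basic
import Literature.Geometry.Lorentzian.CoordTensorRicciIdentity
import Literature.Geometry.Lorentzian.KerrConvergence
import Literature.Geometry.Lorentzian.Sweep2
import HarnessLib

/-!
# The Killing-spinor obstruction field `ζ = (H, S)` of a vacuum spacetime, tensorially

Definition request `defn-KillingSpinorObstructionField` (route `KerrnessPropagates` of the
final state conjecture, items `ObstructionFieldDecay`, `ObstructionPropagatesHomogeneously`).

A vacuum spacetime is locally isometric to Kerr(–NUT) iff it carries a (non-degenerate)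
valence-`2` **Killing spinor** `κ_{AB} = κ_{(AB)}`, `∇_{A'(A} κ_{BC)} = 0`
(Walker–Penrose 1970; García-Parrado–Valiente Kroon 2008, App. A, Prop. 7). For an *arbitrary*
symmetric spinor `κ_{AB}` on a vacuum spacetime García-Parrado and Valiente Kroon
(J. Geom. Phys. 58 (2008) 1186, §7, Prop. 5 and its proof) introduce the **zero quantities**

* `H_{A'ABC} := 3 ∇_{A'(A} κ_{BC)}` (the Killing-spinor defect),
* `ξ_{AA'} := ∇^{D}{}_{A'} κ_{DA}` (the Killing vector candidate) and
  `S_{AA'BB'} := ∇_{AA'} ξ_{BB'} + ∇_{BB'} ξ_{AA'}` (its Killing defect),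

and prove: if `κ` solves the **propagation (wave) equation** `□κ_{AB} + Ψ_{ABPQ} κ^{PQ} = 0`, then
`(H, S)` solves a *closed homogeneous* linear system of wave equations
`□H = 4(Ψ·H + ∇S)`, `□S = −∇(Ψ·H) − ∇(Ψ·H) + 2Ψ·S + 2Ψ̄·S` (loc. cit., eqs.
(Kspinor:propagation), (Kvector:propagation)), while `∇^{CA'} H_{A'ABC} = □κ_{AB} + Ψ_{ABPQ} κ^{PQ}`
identically; hence zero Cauchy data for `(H, S)` propagate and `κ` is a Killing spinor near the
initial hypersurface. The route needs these objects as honest fields with energies, on exact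
Kerr and on a dynamical `Spacetime 4`.

## Tensorial rendering (this file)

The tree has no spinor bundles, so everything is written **tensorially, in a chart**, for the
components `G : E4 → (E4 →L[ℝ] E4 →L[ℝ] ℝ)` of a Lorentzian metric on an open subset of
`E4 = ℝ⁴` (e.g. `Kerr.bilin M a` on `Kerr.region a r₀`, a `ModelBackground`, or the pulled-back
metric `Spacetime.chartBilin` of a dynamical spacetime along a chart), using the coordinate
Levi-Civita calculus of `CoordCurvature` / `CoordTensorCalculus` / `CoordTensorRicciIdentity`
(`MetricCoord.chrCoef`, `MetricCoord.ginv`, `MetricCoord.riemCoef` in the standard basis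
`E4.stdBasis`). Under the standard dictionary `κ_{ab} = κ_{AB} ε̄_{A'B'}` between symmetric
spinors and complex (anti-)self-dual `2`-forms (Penrose–Rindler, *Spinors and space-time* I,
§3.4):

* a **Killing-spinor candidate** is a field of complex antisymmetric `2`-tensors
  `κ : E4 → (Fin 4 → Fin 4 → ℂ)` (components `κ_{ab}`), intended self-dual
  (`KillingSpinor.IsSelfDual`) — all operators below are `ℝ`-linear with real coefficients, so
  they act alike on self-dual, anti-self-dual and general complex `2`-forms;
* `KillingSpinor.div G κ` is `ξ_c = ∇^b κ_{bc}` — spinorially exactly GP–VK's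
  `ξ_{AA'} = ∇^{D}{}_{A'} κ_{DA}`;
* `KillingSpinor.ckyOp G κ` is the **conformal Killing–Yano (twistor) operator**
  `T(κ)_{abc} = ∇_a κ_{bc} − ∇_{[a} κ_{bc]} − ⅓ (g_{ab} ξ_c − g_{ac} ξ_b)`, the projection of `∇κ`
  off its `Λ³ ⊕ Λ¹` parts (Frolov–Krtouš–Kubizňák 2017, §2.5, eq. (CKY) with `p = 2`, `D = 4`);
  for self-dual `κ` it is the `(3/2, 1/2)` part of `∇κ`, i.e.
  `T(κ)_{abc} = (∇_{A'(A} κ_{BC)}) ε̄_{B'C'} = ⅓ H_{A'ABC} ε̄_{B'C'}` — GP–VK's `H` up to the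
  factor `3` (Penrose–Rindler II, §6.7: Killing spinors = self-dual conformal Killing–Yano
  `2`-forms);
* `KillingSpinor.killingDefect G κ` is `S_{ab} = ∇_a ξ_b + ∇_b ξ_a` (GP–VK's normalisation,
  `= 2∇_{(a} ξ_{b)}`);
* `KillingSpinor.propagationOp G κ` is `P(κ)_{ab} = □κ_{ab} − ½ R_{ab}{}^{cd} κ_{cd}`
  (`□ = g^{cd} ∇_c ∇_d`; `R_{abc}{}^{d}` in the convention `[∇_a, ∇_b] ω_c = R_{abc}{}^{d} ω_d` of
  Wald (3.2.11) / Frolov–Krtouš–Kubizňák, which in terms of this tree's curvature endomorphism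
  `R(X, Y) = [∇_X, ∇_Y] − ∇_{[X,Y]}`, `R(e_c, e_d) e_i = Σ_m R^m_{cdi} e_m` (`MetricCoord.riemCoef`),
  reads `R_{cd}{}^{ab} κ_{ab} = Σ_{i j m} g^{ij} R^m_{cdi} κ_{mj}`, see `KillingSpinor.curvAction`). In
  vacuum `R = C` and, with `C_{abcd} = Ψ_{ABCD} ε̄_{A'B'} ε̄_{C'D'} + c.c.`, `P(κ)` is the tensor
  form of `□κ_{AB} + Ψ_{ABPQ} κ^{PQ}` (GP–VK use signature `(+,−,−,−)`; in the `(−,+,+,+)`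
  signature of this tree `□` changes sign relative to the curvature term, whence the minus sign).
  The relative sign is pinned down convention-independently by the **Killing–Yano integrability
  identity**: for a Killing–Yano `2`-form `f` on a vacuum background
  `∇_a ∇_b f_{cd} = (3/2) R_{ea[bc} f^{e}{}_{d]}` (Frolov–Krtouš–Kubizňák 2017, §2.6.2), whose trace is
  `□f_{cd} = ½ R_{cd}{}^{ab} f_{ab}`, i.e. `P(f) = 0`; likewise `P(κ) = 0` for every Killing-spinor
  `2`-form of a vacuum spacetime (GP–VK, eq. (Box_kappa_AB));
* `KillingSpinorObstructionField G κ = ζ = (T(κ), S)` is the **obstruction field**, a map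
  `E4 → (Fin 4 → Fin 4 → Fin 4 → ℂ) × (Fin 4 → Fin 4 → ℂ)` into a real normed space, so that the
  slice energies of `WeightedNorms` / `Sweep2` apply verbatim: `KillingSpinor.obstructionEnergy`
  (weighted `k`-th order `L²` energy through `{x⁰ = τ}`, as `Kerr.teukolskyEnergy`) and
  `KillingSpinor.obstructionSupNorm` (`Cᵏ` sup norm on the truncated time slabs of a
  `ModelBackground`, as `Spacetime.truncDeviationCk`);
* `Spacetime.chartBilin 𝓢 B Ψ` are the components of the pulled-back metric `Ψ^* g` of a
  `Spacetime 4` along a chart map `Ψ : B.domain → 𝓢.carrier` (cf. `Spacetime.deviation`), through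
  which all of the above apply to a dynamical vacuum spacetime with its Levi-Civita connection
  (the coordinate Christoffel symbols of `Ψ^* g` *are* the Levi-Civita connection of `g` in the
  chart; `ChartConnection.lean`): `Spacetime.killingSpinorObstructionField`,
  `Spacetime.killingSpinorPropagationOp`;
* **model solution** (`Kerr` namespace): in the ingoing Kerr–Schild Cartesian chart of
  `KerrSchild.lean` the principal (closed conformal Killing–Yano) tensor of Kerr has the
  *polynomial, mass-independent* components `h = dx⁰ ∧ (x₁ dx¹ + x₂ dx² + x₃ dx³) + a dx¹ ∧ dx²`
  (Frolov–Krtouš–Kubizňák 2017, §3.6.1 eq. (hhhh) and §3.7; the Kerr–Schild null covector `ℓ` of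
  `Kerr.nullCovector` is an eigen-covector, `h_{ab} ℓ^b = r ℓ_a`), its Hodge dual is the
  Killing–Yano tensor `f = ⋆h = −(x₁ dx²∧dx³ + x₂ dx³∧dx¹ + x₃ dx¹∧dx²) + a dx⁰∧dx³`
  (Penrose–Floyd), and `Kerr.killingSpinorForm a = h − i ⋆h` is the self-dual `2`-form of the Kerr
  Killing spinor `κ_{AB} = ψ^{-1/3} o_{(A} ι_{B)} ∝ (r − i a cos θ) o_{(A} ι_{B)}` (Walker–Penrose
  1970; GP–VK App. A, Prop. 7): on the axis it equals `(r − i a cos θ)(dx⁰∧dx³ + i dx¹∧dx²)`.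
  For it `T(κ) = 0`, `S = 0` (`ξ ∝ ∂_{t*}`) and `P(κ) = 0` on `Kerr.region a r₀` — recorded in
  the docstrings as the calibration of all sign conventions (symbolic verification attached to
  the work item as evidence), not asserted as Lean theorems.

## What is *not* done here

No spinor calculus; no statement of the GP–VK propagation theorem itself (a separate
`--kind cite` fact once wanted: its tensorial right-hand sides are lengthy); no energy
estimate. Smoothness is never assumed in the definitions (they are pointwise formulas in
`fderiv`, honest on open sets where the fields are differentiable, junk elsewhere, exactly as
`Kerr.coordDeriv`, `coordEnergyDensity`).

## References

* A. García-Parrado Gómez-Lobo, J. A. Valiente Kroon, *Killing spinor initial data sets*,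
  J. Geom. Phys. 58 (2008) 1186–1202, arXiv:0712.3373, §7 (Prop. 5, eqs. (start-entry_a)–(c),
  (Kspinor:propagation), (Box_kappa_AB), (Box_xi), (Kvector:propagation)), App. A Prop. 7.
  [GomezloboValientekroon2008]
* V. P. Frolov, P. Krtouš, D. Kubizňák, *Black holes, hidden symmetries, and complete
  integrability*, Living Rev. Relativ. 20 (2017) 6, arXiv:1705.05482, §2.5 (conformal
  Killing–Yano forms, eq. (CKY)), §2.6.2 (integrability conditions), §3.6.1 eq. (hhhh), §3.7
  (Kerr–Schild form and the principal tensor). [FrolovKrtousKubiznak2017]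
* M. Walker, R. Penrose, *On quadratic first integrals of the geodesic equations for type {22}
  spacetimes*, Commun. Math. Phys. 18 (1970) 265–274. [WalkerPenrose1970]
* T. Bäckdahl, J. A. Valiente Kroon, Ann. Henri Poincaré 11 (2010) 1225, §2–3 (the same
  objects on Kerr; `κ_{AB}` of Kerr). [BackdahlValientekroon2010]
* R. Penrose, W. Rindler, *Spinors and space-time* I (1984) §3.4, §4.6; II (1986) §6.7.
* R. M. Wald, *General Relativity* (1984), (3.2.11), (C.3.6) (curvature conventions).
* L. Andersson, P. Blue, Ann. Math. 182 (2015) 787, §2 (hidden symmetries of Kerr from the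
  Killing spinor). [AnderssonBlue2015]
-/

noncomputable section

open TopologicalSpace Set MeasureTheory Function
open scoped ENNReal ContDiff Manifold

namespace Literature.Geometry.Lorentzian

/-! ### The standard basis of `E4` as a `Module.Basis` -/

namespace E4

/-- The standard basis `e_μ = EuclideanSpace.single μ 1` of `E4 = ℝ⁴` as a `Module.Basis`
(the basis fed to the coordinate tensor calculus `MetricCoord.*`). [folklore] -/
def stdBasis : Module.Basis (Fin 4) ℝ E4 := (EuclideanSpace.basisFun (Fin 4) ℝ).toBasis

/-- `stdBasis μ = e_μ = E4.basisVector μ`. [folklore] -/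
@[simp]
theorem stdBasis_apply (μ : Fin 4) : stdBasis μ = basisVector μ := by
  rw [stdBasis, OrthonormalBasis.coe_toBasis, EuclideanSpace.basisFun_apply]

/-- The **Levi-Civita symbol** `[a b c d] ∈ {0, ±1}` on `Fin 4`: the determinant of the matrix
with rows `e_a, e_b, e_c, e_d` (the sign of the permutation, `0` on repeated indices;
`[0 1 2 3] = 1`). Penrose–Rindler I (1984), (3.3.31) ff. [folklore] -/
def leviCivitaSymbol (a b c d : Fin 4) : ℝ :=
  (Matrix.of fun i j : Fin 4 ↦ if ![a, b, c, d] i = j then (1 : ℝ) else 0).det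

end E4

/-! ### Coordinate Levi-Civita calculus for complex covariant tensors on a chart of `E4` -/

namespace KillingSpinor

variable (G : E4 → E4 →L[ℝ] E4 →L[ℝ] ℝ)

/-- The metric components `g_{ab}(x) = G_x(e_a, e_b)`, as complex numbers.
[cite: ONeill1983, Ch. 3, Lemma 3.4] -/
def gLo (x : E4) (a b : Fin 4) : ℂ := (G x (E4.basisVector a) (E4.basisVector b) : ℂ)

/-- The inverse metric components `g^{ab}(x)` (`MetricCoord.ginv` in the standard basis), as
complex numbers. [cite: ONeill1983, Ch. 3, p. 60] -/
def gUp (x : E4) (a b : Fin 4) : ℂ := (MetricCoord.ginv G E4.stdBasis x a b : ℂ)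

/-- The Christoffel symbols `Γ^m_{ab}(x)` of the Levi-Civita connection of `G`
(`MetricCoord.chrCoef` in the standard basis), as complex numbers.
[cite: ONeill1983, Ch. 3, Prop. 3.13] -/
def christoffel (x : E4) (a b m : Fin 4) : ℂ := (MetricCoord.chrCoef G E4.stdBasis x a b m : ℂ)

/-- The curvature components `R^m_{cdi}(x)`, `R(e_c, e_d) e_i = Σ_m R^m_{cdi} e_m` with
`R(X, Y) = [∇_X, ∇_Y] − ∇_{[X,Y]}` (`MetricCoord.riemCoef` in the standard basis), as complex
numbers. In Wald's convention `[∇_c, ∇_d] ω_i = R_{cdi}{}^{m} ω_m` one has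
`R^m_{cdi} = −R_{cdi}{}^{m}` (Wald 1984, (3.2.11)–(3.2.12)). [cite: ONeill1983, Ch. 3, Lemma 3.38] -/
def riemann (x : E4) (c d i m : Fin 4) : ℂ := (MetricCoord.riemCoef G E4.stdBasis x c d i m : ℂ)

/-- The metric determinant `det (g_{ab}(x))` in the standard basis. [cite: ONeill1983, Ch. 7, Lemma 7.19 ff] -/
def metricDet (x : E4) : ℝ :=
  (Matrix.of fun i j : Fin 4 ↦ G x (E4.basisVector i) (E4.basisVector j)).det

section Operators

variable {V : Type*} [NormedAddCommGroup V] [NormedSpace ℝ V]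

/-- The coordinate partial derivative `∂_a F (x) = DF(x) e_a` of a vector-valued field on `E4`
(Mathlib's `fderiv`; honest where `F` is differentiable, junk `0` elsewhere — the device of
`Kerr.coordDeriv`, `coordEnergyDensity`). [folklore] -/
def pd (F : E4 → V) (x : E4) (a : Fin 4) : V := fderiv ℝ F x (E4.basisVector a)

end Operators

/-- Covariant derivative of a complex covector field: `(∇ξ)_{ab} = ∂_a ξ_b − Γ^m_{ab} ξ_m`.
[cite: ONeill1983, Ch. 2, Prop. 2.13] -/
def covD₁ (ξ : E4 → Fin 4 → ℂ) (x : E4) (a b : Fin 4) : ℂ :=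
  pd ξ x a b - ∑ m, christoffel G x a b m * ξ x m

/-- Covariant derivative of a complex covariant `2`-tensor field:
`(∇κ)_{abc} = ∂_a κ_{bc} − Γ^m_{ab} κ_{mc} − Γ^m_{ac} κ_{bm}`. [cite: ONeill1983, Ch. 2, Prop. 2.13] -/
def covD₂ (κ : E4 → Fin 4 → Fin 4 → ℂ) (x : E4) (a b c : Fin 4) : ℂ :=
  pd κ x a b c - ∑ m, (christoffel G x a b m * κ x m c + christoffel G x a c m * κ x b m)

/-- Covariant derivative of a complex covariant `3`-tensor field:
`(∇N)_{adbc} = ∂_a N_{dbc} − Γ^m_{ad} N_{mbc} − Γ^m_{ab} N_{dmc} − Γ^m_{ac} N_{dbm}`.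
[cite: ONeill1983, Ch. 2, Prop. 2.13] -/
def covD₃ (N : E4 → Fin 4 → Fin 4 → Fin 4 → ℂ) (x : E4) (a d b c : Fin 4) : ℂ :=
  pd N x a d b c - ∑ m, (christoffel G x a d m * N x m b c + christoffel G x a b m * N x d m c +
    christoffel G x a c m * N x d b m)

/-- **The Killing vector candidate `ξ` of a Killing-spinor candidate `κ`**: the divergence
`ξ_c = ∇^b κ_{bc} = Σ_{ab} g^{ab} (∇κ)_{abc}` (a complex covector field). Under
`κ_{ab} = κ_{AB} ε̄_{A'B'}` this is exactly `ξ_{AA'} = ∇^{D}{}_{A'} κ_{DA}` of García-Parrado–Valiente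
Kroon, J. Geom. Phys. 58 (2008), §7, proof of Prop. 5, eq. (start-entry_b) (no factor: the
payload's "`1/3?`" is the Killing–Yano normalisation `ξ^{FKK} = ⅓ ∇·h` of Frolov–Krtouš–Kubizňák
(2017) §2.8, which is `⅓` of this one); in vacuum, if `κ` is a Killing spinor, `ξ` is a (complex)
Killing vector (loc. cit., Introduction). For the Kerr model solution `Kerr.killingSpinorForm`
on `Kerr.bilin M a`, `ξ` is a constant multiple of `g(∂_{t*}, ·)`.
[cite: GomezloboValientekroon2008, §7 Prop. 5 proof, eq. (start-entry_b)] -/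
def div (κ : E4 → Fin 4 → Fin 4 → ℂ) (x : E4) (c : Fin 4) : ℂ :=
  ∑ a, ∑ b, gUp G x a b * covD₂ G κ x a b c

/-- **The conformal Killing–Yano (twistor) operator** on complex `2`-forms:
`T(κ)_{abc} = ∇_a κ_{bc} − ∇_{[a} κ_{bc]} − ⅓ (g_{ab} ξ_c − g_{ac} ξ_b)`, `ξ = KillingSpinor.div G κ`
— the projection of `∇κ` off its totally antisymmetric (`Λ³`) and trace (`Λ¹`) parts, so that
`T(κ) = 0` is the conformal Killing–Yano equation
`∇_X κ = ⅓ X ⌟ dκ − ⅓ X♭ ∧ δκ` (Frolov–Krtouš–Kubizňák, Living Rev. Relativ. 20 (2017) 6, §2.5,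
eq. (CKY) with `p = 2`, `D = 4`). For self-dual `κ_{ab} = κ_{AB} ε̄_{A'B'}` this is the
`(3/2,1/2)`-part of `∇κ`: `T(κ)_{abc} = (∇_{A'(A} κ_{BC)}) ε̄_{B'C'} = ⅓ H_{A'ABC} ε̄_{B'C'}` with the
zero quantity `H_{A'ABC} = 3∇_{A'(A} κ_{BC)}` of García-Parrado–Valiente Kroon (2008), §7, eq.
(start-entry_a) (Penrose–Rindler II (1986), §6.7); `T(κ) = 0` iff `κ_{AB}` is a Killing spinor.
This is the component `H` of `KillingSpinorObstructionField`.
[cite: GomezloboValientekroon2008, §7 Prop. 5 proof, eq. (start-entry_a)] -/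
def ckyOp (κ : E4 → Fin 4 → Fin 4 → ℂ) (x : E4) (a b c : Fin 4) : ℂ :=
  covD₂ G κ x a b c
    - (1 / 3 : ℂ) * (covD₂ G κ x a b c + covD₂ G κ x b c a + covD₂ G κ x c a b)
    - (1 / 3 : ℂ) * (gLo G x a b * div G κ x c - gLo G x a c * div G κ x b)

/-- **The Killing defect `S` of the Killing vector candidate**:
`S_{ab} = ∇_a ξ_b + ∇_b ξ_a` with `ξ = KillingSpinor.div G κ` (`= 2∇_{(a} ξ_{b)}`; García-Parrado–
Valiente Kroon (2008), §7, eq. (start-entry_c): `S_{AA'BB'} = ∇_{AA'} ξ_{BB'} + ∇_{BB'} ξ_{AA'}`).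
`S = 0` iff `ξ` is a (complex) Killing vector. This is the component `S` of
`KillingSpinorObstructionField`. [cite: GomezloboValientekroon2008, §7 Prop. 5 proof, eq. (start-entry_c)] -/
def killingDefect (κ : E4 → Fin 4 → Fin 4 → ℂ) (x : E4) (a b : Fin 4) : ℂ :=
  covD₁ G (div G κ) x a b + covD₁ G (div G κ) x b a

/-- **The curvature action on `2`-forms** `(R⋆κ)_{cd} = R_{cd}{}^{ab} κ_{ab}` (indices of
`R_{abc}{}^{d}` in Wald's convention `[∇_a,∇_b] ω_c = R_{abc}{}^{d} ω_d`), written with this tree's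
curvature endomorphism `R(X,Y) = [∇_X,∇_Y] − ∇_{[X,Y]}`, `R(e_c,e_d) e_i = Σ_m R^m_{cdi} e_m`
(`MetricCoord.riemCoef`; `R^m_{cdi} = −R_{cdi}{}^{m}`, Wald (3.2.12)):
`(R⋆κ)_{cd} = Σ_{i j m} g^{ij} R^m_{cdi} κ_{mj}` (`= tr_g` of `(u, v) ↦ κ(R(e_c,e_d) u, v)`). In vacuum
`R = C` and, for self-dual `κ_{ab} = κ_{AB} ε̄_{A'B'}`, `½ C_{cd}{}^{ab} κ_{ab}` is the tensor form of
`Ψ_{CDPQ} κ^{PQ} ε̄_{C'D'}` (Penrose–Rindler I, (4.6.41)). Frolov–Krtouš–Kubizňák (2017), §2.6.2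
(curvature conventions as in Wald/MTW). [cite: FrolovKrtousKubiznak2017, §2.6.2] -/
def curvAction (κ : E4 → Fin 4 → Fin 4 → ℂ) (x : E4) (c d : Fin 4) : ℂ :=
  ∑ i, ∑ j, ∑ m, gUp G x i j * riemann G x c d i m * κ x m j

/-- **The tensor wave operator** `(□κ)_{bc} = g^{ad} (∇∇κ)_{adbc} = ∇^a ∇_a κ_{bc}` on complex
covariant `2`-tensor fields (García-Parrado–Valiente Kroon (2008) write `□ = ∇^a ∇_a`; Frolov–
Krtouš–Kubizňák (2017), §2.6.2). [cite: FrolovKrtousKubiznak2017, §2.6.2] -/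
def waveOp (κ : E4 → Fin 4 → Fin 4 → ℂ) (x : E4) (b c : Fin 4) : ℂ :=
  ∑ a, ∑ d, gUp G x a d * covD₃ G (covD₂ G κ) x a d b c

/-- **The Killing-spinor propagation operator** `P(κ)_{ab} = □κ_{ab} − ½ R_{ab}{}^{cd} κ_{cd}`
(`KillingSpinor.waveOp − ½ KillingSpinor.curvAction`): the tensor form, in the conventions of this
tree (signature `(−,+,+,+)`, `R(X,Y) = [∇_X,∇_Y] − ∇_{[X,Y]}`), of García-Parrado–Valiente Kroon's
`□κ_{AB} + Ψ_{ABPQ} κ^{PQ}` (J. Geom. Phys. 58 (2008), §7, Prop. 5, the hypothesis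
`□κ_{AB} + Ψ_{ABPQ} κ^{PQ} = 0`, and eq. (Box_kappa_AB): `∇^{CA'} H_{A'ABC} = □κ_{AB} + Ψ_{ABPQ} κ^{PQ}`,
signature `(+,−,−,−)`, vacuum). The relative sign is fixed by the Killing–Yano integrability
identity `∇_a ∇_b f_{cd} = (3/2) R_{ea[bc} f^{e}{}_{d]}` (Frolov–Krtouš–Kubizňák (2017), §2.6.2, eq.
after (KYeqkapidx)), whose trace on a vacuum background is `□f_{cd} = ½ R_{cd}{}^{ab} f_{ab}`, i.e.
`P(f) = 0` for Killing–Yano `2`-forms; every Killing-spinor `2`-form of a vacuum spacetime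
satisfies `P(κ) = 0`, in particular the Kerr model solution `Kerr.killingSpinorForm` on
`Kerr.bilin M a` (symbolic verification attached to `defn-KillingSpinorObstructionField`). Off
vacuum the full Riemann tensor is kept (only vacuum use is intended).
[cite: GomezloboValientekroon2008, §7 Prop. 5, eq. (Box_kappa_AB)] -/
def propagationOp (κ : E4 → Fin 4 → Fin 4 → ℂ) (x : E4) (a b : Fin 4) : ℂ :=
  waveOp G κ x a b - (1 / 2 : ℂ) * curvAction G κ x a b

/-- **The propagation equation** `□κ + Riem⋆κ = 0` on a set `W ⊆ E4` (GP–VK's hypothesis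
"`□κ_{AB} + Ψ_{ABPQ} κ^{PQ} = 0` holds on an open set `𝒲 ⊇ 𝒮₀`", J. Geom. Phys. 58 (2008), §7,
Prop. 5): `KillingSpinor.propagationOp G κ x = 0` for `x ∈ W`.
[cite: GomezloboValientekroon2008, §7 Prop. 5] -/
def SolvesPropagation (W : Set E4) (κ : E4 → Fin 4 → Fin 4 → ℂ) : Prop :=
  ∀ x ∈ W, propagationOp G κ x = 0

/-- **Hodge dual of a complex `2`-form** in the chart orientation `e₀ ∧ e₁ ∧ e₂ ∧ e₃`:
`(⋆κ)_{ab} = ½ ε_{ab}{}^{cd} κ_{cd} = ½ √|det g| Σ_{cdef} [a b c d] g^{ce} g^{df} κ_{ef}`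
(`ε_{0123} = +√|det g|`). Penrose–Rindler I (1984), (3.4.21) ff.; Frolov–Krtouš–Kubizňák (2017),
§2.5 / App. (Hodge duality of conformal Killing–Yano forms). [cite: FrolovKrtousKubiznak2017, §2.5] -/
def hodge (κ : E4 → Fin 4 → Fin 4 → ℂ) (x : E4) (a b : Fin 4) : ℂ :=
  (1 / 2 : ℂ) * ∑ c, ∑ d, ∑ e, ∑ f,
    ((√|metricDet G x| * E4.leviCivitaSymbol a b c d * MetricCoord.ginv G E4.stdBasis x c e *
      MetricCoord.ginv G E4.stdBasis x d f : ℝ) : ℂ) * κ x e f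

/-- A complex `2`-form field is **self-dual** on `W` if `⋆κ = i κ` there (Lorentzian signature:
`⋆⋆ = −1` on `2`-forms, eigenvalues `±i`); its complex conjugate is then anti-self-dual. Under
`κ_{ab} = κ_{AB} ε̄_{A'B'}` symmetric spinors correspond to one of the two eigenspaces, which one
being a matter of orientation convention (Penrose–Rindler I (1984), (3.4.22), (3.4.39): with
their orientation, unprimed = anti-self-dual). The Kerr model solution `Kerr.killingSpinorForm`
is self-dual for the chart orientation `e₀∧e₁∧e₂∧e₃` used in `KillingSpinor.hodge`. [folklore] -/
def IsSelfDual (W : Set E4) (κ : E4 → Fin 4 → Fin 4 → ℂ) : Prop :=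
  ∀ x ∈ W, hodge G κ x = Complex.I • κ x

/-- A complex `2`-form field is **anti-self-dual** on `W` if `⋆κ = −i κ` there
(Penrose–Rindler I (1984), (3.4.39)). [folklore] -/
def IsAntiSelfDual (W : Set E4) (κ : E4 → Fin 4 → Fin 4 → ℂ) : Prop :=
  ∀ x ∈ W, hodge G κ x = -(Complex.I • κ x)

/-- A field of complex `2`-tensors is a field of **`2`-forms** (antisymmetric) — the carrier of
Killing-spinor candidates `κ_{ab} = κ_{(AB)} ε̄_{A'B'} = −κ_{ba}` (Penrose–Rindler I, (3.4.17)). [folklore] -/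
def IsTwoForm (κ : E4 → Fin 4 → Fin 4 → ℂ) : Prop :=
  ∀ x a b, κ x a b = -κ x b a

end KillingSpinor

/-! ### The obstruction field and its energies -/

/-- **The Killing-spinor obstruction field `ζ = (H, S)` of a Killing-spinor candidate `κ`** on a
chart with metric components `G`: the pair of zero quantities
`ζ(x) = (T(κ)(x), S(x)) = (KillingSpinor.ckyOp G κ x, KillingSpinor.killingDefect G κ x)` —
the conformal Killing–Yano defect of `κ` (spinorially `∇_{A'(A} κ_{BC)} = ⅓ H_{A'ABC}`) and the
Killing defect `S_{ab} = ∇_a ξ_b + ∇_b ξ_a` of `ξ_c = ∇^b κ_{bc}` — valued in the real normed space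
`(Fin 4 → Fin 4 → Fin 4 → ℂ) × (Fin 4 → Fin 4 → ℂ)`, so that coordinate `Cᵏ` / Sobolev energies
apply (`KillingSpinor.obstructionEnergy`, `KillingSpinor.obstructionSupNorm`). García-Parrado–
Valiente Kroon, J. Geom. Phys. 58 (2008), §7, Prop. 5: on a vacuum spacetime, if `κ` solves the
propagation equation `KillingSpinor.SolvesPropagation` then `ζ` solves a closed homogeneous linear
system of wave equations ((Kspinor:propagation), (Kvector:propagation)), and `ζ ≡ 0` iff `κ` is a
Killing spinor with Killing vector `ξ`; `ζ = 0` for the Kerr model `Kerr.killingSpinorForm`.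
[cite: GomezloboValientekroon2008, §7 Prop. 5] -/
def KillingSpinorObstructionField (G : E4 → E4 →L[ℝ] E4 →L[ℝ] ℝ) (κ : E4 → Fin 4 → Fin 4 → ℂ)
    (x : E4) : (Fin 4 → Fin 4 → Fin 4 → ℂ) × (Fin 4 → Fin 4 → ℂ) :=
  (KillingSpinor.ckyOp G κ x, KillingSpinor.killingDefect G κ x)

namespace KillingSpinor

variable (G : E4 → E4 →L[ℝ] E4 →L[ℝ] ℝ)

/-- **Weighted `k`-th order energy of the obstruction field through a Kerr–Schild-type slice**
`{x⁰ = τ} ∩ {y ∈ A}` of the chart domain `U`: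
`sliceSobolevEnergy U (ζ|_U) τ k p A = ∫_{y ∈ A, (τ,y) ∈ U} (1+‖y‖)^p Σ_{m ≤ k} ‖D^m ζ(τ,y)‖² dy`
with `ζ = KillingSpinorObstructionField G κ` — the same functional as `Kerr.teukolskyEnergy`
(`Sweep2`), for backgrounds whose time function is `x⁰` (`Kerr.background`,
`Minkowski.background`: `U = Kerr.region a r₀`, `G = Kerr.bilin M a`). Dafermos–Rodnianski
arXiv:0811.0354, §4; García-Parrado–Valiente Kroon (2008), §7 (the fields). [cite: GomezloboValientekroon2008, §7] -/
def obstructionEnergy (U : Opens E4) (κ : E4 → Fin 4 → Fin 4 → ℂ) (τ : ℝ) (k : ℕ) (p : ℝ)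
    (A : Set E3) : ℝ≥0∞ :=
  sliceSobolevEnergy U (fun x : U ↦ KillingSpinorObstructionField G κ x.1) τ k p A

/-- **`Cᵏ` sup norm of the obstruction field on a truncated time slab** `{t = τ, r ≤ R}` of a
reference background `B : ModelBackground` (metric components `B.bilin`, any time function
`B.time`): `supCkENorm (B.truncTimeSlab R τ) k ζ`, the quantity measuring pointwise decay, as
`Spacetime.truncDeviationCk` does for metric deviations (DHRT arXiv:2104.08222, §1).
García-Parrado–Valiente Kroon (2008), §7 (the fields). [cite: GomezloboValientekroon2008, §7] -/
def obstructionSupNorm (B : ModelBackground) (κ : E4 → Fin 4 → Fin 4 → ℂ) (k : ℕ) (R τ : ℝ) :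
    ℝ≥0∞ :=
  supCkENorm (Subtype.val '' B.truncTimeSlab R τ) k (KillingSpinorObstructionField B.bilin κ)

end KillingSpinor

/-! ### Unfolding and sanity lemmas -/

namespace KillingSpinor

variable (G : E4 → E4 →L[ℝ] E4 →L[ℝ] ℝ)

/-- The partial derivatives of the zero field vanish. [folklore] -/
@[simp]
theorem pd_zero {V : Type*} [NormedAddCommGroup V] [NormedSpace ℝ V] (x : E4) (a : Fin 4) :
    pd (0 : E4 → V) x a = 0 := by
  simp [pd]

/-- `∇0 = 0` for covectors. [cite: ONeill1983, Ch. 2, Prop. 2.13] -/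
@[simp]
theorem covD₁_zero : covD₁ G 0 = 0 := by
  funext x a b
  simp [covD₁]

/-- `∇0 = 0` for `2`-tensors. [cite: ONeill1983, Ch. 2, Prop. 2.13] -/
@[simp]
theorem covD₂_zero : covD₂ G 0 = 0 := by
  funext x a b c
  simp [covD₂]

/-- `∇0 = 0` for `3`-tensors. [cite: ONeill1983, Ch. 2, Prop. 2.13] -/
@[simp]
theorem covD₃_zero : covD₃ G 0 = 0 := by
  funext x a d b c
  simp [covD₃]

/-- The Killing vector candidate of `κ = 0` vanishes. [cite: GomezloboValientekroon2008, §7] -/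
@[simp]
theorem div_zero : div G 0 = 0 := by
  funext x c
  simp [div]

/-- `T(0) = 0`. [cite: GomezloboValientekroon2008, §7] -/
@[simp]
theorem ckyOp_zero : ckyOp G 0 = 0 := by
  funext x a b c
  simp [ckyOp]

/-- `S(0) = 0`. [cite: GomezloboValientekroon2008, §7] -/
@[simp]
theorem killingDefect_zero : killingDefect G 0 = 0 := by
  funext x a b
  simp [killingDefect]

/-- `R⋆0 = 0`. [cite: FrolovKrtousKubiznak2017, §2.6.2] -/
@[simp]
theorem curvAction_zero : curvAction G 0 = 0 := by
  funext x c d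
  simp [curvAction]

/-- `□0 = 0`. [cite: FrolovKrtousKubiznak2017, §2.6.2] -/
@[simp]
theorem waveOp_zero : waveOp G 0 = 0 := by
  funext x b c
  simp [waveOp]

/-- `P(0) = 0`: the zero field solves the propagation equation (the solution class of
`SolvesPropagation` is non-empty). [cite: GomezloboValientekroon2008, §7 Prop. 5] -/
@[simp]
theorem propagationOp_zero : propagationOp G 0 = 0 := by
  funext x a b
  simp [propagationOp]

/-- The zero field solves the propagation equation on every set. [cite: GomezloboValientekroon2008, §7 Prop. 5] -/
theorem solvesPropagation_zero (W : Set E4) : SolvesPropagation G W 0 := fun x _ ↦ by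
  simp

/-- Unfolding lemma: `P(κ) = □κ − ½ R⋆κ`. [cite: GomezloboValientekroon2008, §7 Prop. 5] -/
theorem propagationOp_apply (κ : E4 → Fin 4 → Fin 4 → ℂ) (x : E4) (a b : Fin 4) :
    propagationOp G κ x a b = waveOp G κ x a b - (1 / 2 : ℂ) * curvAction G κ x a b := rfl

/-- Unfolding lemma: the components of the obstruction field are `(T(κ), S)`.
[cite: GomezloboValientekroon2008, §7 Prop. 5] -/
theorem _root_.Literature.Geometry.Lorentzian.killingSpinorObstructionField_apply
    (κ : E4 → Fin 4 → Fin 4 → ℂ) (x : E4) :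
    KillingSpinorObstructionField G κ x = (ckyOp G κ x, killingDefect G κ x) := rfl

/-- The obstruction field of the zero candidate vanishes. [cite: GomezloboValientekroon2008, §7 Prop. 5] -/
@[simp]
theorem _root_.Literature.Geometry.Lorentzian.killingSpinorObstructionField_zero :
    KillingSpinorObstructionField G 0 = 0 := by
  funext x
  simp [KillingSpinorObstructionField]

/-- The energies of the zero candidate vanish (the class is non-empty and the energy functional
is not identically `⊤`). [cite: GomezloboValientekroon2008, §7] -/
@[simp]
theorem obstructionEnergy_zero (U : Opens E4) (τ : ℝ) (k : ℕ) (p : ℝ) (A : Set E3) :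
    obstructionEnergy G U 0 τ k p A = 0 := by
  simp only [obstructionEnergy, killingSpinorObstructionField_zero, Pi.zero_apply]
  exact sliceSobolevEnergy_zero U τ k p A

/-- The sup norms of the zero candidate vanish. [cite: GomezloboValientekroon2008, §7] -/
@[simp]
theorem obstructionSupNorm_zero (B : ModelBackground) (k : ℕ) (R τ : ℝ) :
    obstructionSupNorm B 0 k R τ = 0 := by
  simp only [obstructionSupNorm, killingSpinorObstructionField_zero]
  exact supCkENorm_zero _ k

end KillingSpinor

/-! ### Dynamical spacetimes: the pulled-back metric components along a chart -/

namespace Spacetime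

universe u

variable (𝓢 : Spacetime.{u} 4) (B : ModelBackground)

/-- **The components of the pulled-back metric `Ψ^* g` of a spacetime along a chart map**
`Ψ : B.domain → 𝓢.carrier` (`B : ModelBackground` supplies the open coordinate domain
`B.domain ⊆ E4`, whose tangent spaces are `E4` definitionally): at `x ∈ B.domain` the continuous
bilinear form `(v, w) ↦ g_{Ψ x}(dΨ_x v, dΨ_x w)` (`pullbackBilin`), written as
`(Ψ^* g − g₀) + g₀ = Spacetime.deviationExtend + B.bilin` so that the API of `Spacetime.deviation`
applies (`chartBilin_coe_apply`); off the domain it is the junk value `B.bilin` (never used). When `Ψ` is a local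
diffeomorphism these are the components of the spacetime metric `g` in the chart `Ψ`, and the
coordinate Christoffel symbols / curvature of `KillingSpinor.christoffel (𝓢.chartBilin B Ψ)` are
those of the Levi-Civita connection of `g` (O'Neill 1983, Ch. 3, Prop. 3.13, Lemma 3.38;
`ChartConnection.lean`). This is how the Killing-spinor objects of this file are read on a
dynamical `Spacetime 4`. [cite: ONeill1983, Ch. 3, Def. 3.9 and Prop. 3.13] -/
def chartBilin (Ψ : B.domain → 𝓢.carrier) : E4 → E4 →L[ℝ] E4 →L[ℝ] ℝ :=
  fun y ↦ 𝓢.deviationExtend B Ψ y + B.bilin y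

/-- On the domain, `chartBilin` is the pulled-back metric `Ψ^* g = (Ψ^* g − g₀) + g₀`
(`Spacetime.deviation`; DHRT arXiv:2104.08222, §1). [cite: arXiv210408222] -/
theorem chartBilin_coe (Ψ : B.domain → 𝓢.carrier) (x : B.domain) :
    𝓢.chartBilin B Ψ x = 𝓢.deviation B Ψ x + B.bilin x.1 := by
  simp [chartBilin]

/-- Unfolding lemma: `chartBilin Ψ x v w = g_{Ψ x}(dΨ_x v, dΨ_x w)` on the domain
(O'Neill 1983, Ch. 3, Def. 3.9: the pullback metric). [cite: ONeill1983, Ch. 3, Def. 3.9] -/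
theorem chartBilin_coe_apply (Ψ : B.domain → 𝓢.carrier) (x : B.domain) (v w : E4) :
    𝓢.chartBilin B Ψ x v w =
      𝓢.metric.val (Ψ x) (mfderiv 𝓘(ℝ, E4) (𝓡 4) Ψ x v) (mfderiv 𝓘(ℝ, E4) (𝓡 4) Ψ x w) := by
  simp [chartBilin, deviation_apply]

/-- Off the domain, `chartBilin` is the junk value `B.bilin` (never used; cf.
`Spacetime.deviationExtend_of_not_mem`). [cite: arXiv210408222] -/
theorem chartBilin_of_not_mem (Ψ : B.domain → 𝓢.carrier) {y : E4} (hy : y ∉ B.domain) :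
    𝓢.chartBilin B Ψ y = B.bilin y := by
  show 𝓢.deviationExtend B Ψ y + B.bilin y = B.bilin y
  rw [𝓢.deviationExtend_of_not_mem B Ψ hy]
  exact zero_add (B.bilin y)

/-- **The Killing-spinor obstruction field of a dynamical spacetime in a chart**: the field
`ζ = (H, S)` (`KillingSpinorObstructionField`) of the candidate `κ` (components in the chart)
with respect to the pulled-back metric `Ψ^* g` and its Levi-Civita connection. García-Parrado–
Valiente Kroon, J. Geom. Phys. 58 (2008), §7, Prop. 5. [cite: GomezloboValientekroon2008, §7 Prop. 5] -/
def killingSpinorObstructionField (Ψ : B.domain → 𝓢.carrier) (κ : E4 → Fin 4 → Fin 4 → ℂ) :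
    E4 → (Fin 4 → Fin 4 → Fin 4 → ℂ) × (Fin 4 → Fin 4 → ℂ) :=
  KillingSpinorObstructionField (𝓢.chartBilin B Ψ) κ

/-- **The Killing-spinor propagation operator of a dynamical spacetime in a chart**:
`P(κ) = □_g κ − ½ Riem_g ⋆ κ` (`KillingSpinor.propagationOp`) for the pulled-back metric `Ψ^* g`.
García-Parrado–Valiente Kroon, J. Geom. Phys. 58 (2008), §7, Prop. 5 (`□κ_{AB} + Ψ_{ABPQ} κ^{PQ}`).
[cite: GomezloboValientekroon2008, §7 Prop. 5] -/
def killingSpinorPropagationOp (Ψ : B.domain → 𝓢.carrier) (κ : E4 → Fin 4 → Fin 4 → ℂ) :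
    E4 → Fin 4 → Fin 4 → ℂ :=
  KillingSpinor.propagationOp (𝓢.chartBilin B Ψ) κ

/-- The obstruction field of the zero candidate vanishes on every spacetime. [cite: GomezloboValientekroon2008, §7 Prop. 5] -/
@[simp]
theorem killingSpinorObstructionField_zero (Ψ : B.domain → 𝓢.carrier) :
    𝓢.killingSpinorObstructionField B Ψ 0 = 0 := by
  simp [killingSpinorObstructionField]

/-- The zero candidate solves the propagation equation on every spacetime. [cite: GomezloboValientekroon2008, §7 Prop. 5] -/
@[simp]
theorem killingSpinorPropagationOp_zero (Ψ : B.domain → 𝓢.carrier) :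
    𝓢.killingSpinorPropagationOp B Ψ 0 = 0 := by
  simp [killingSpinorPropagationOp]

end Spacetime

/-! ### The model solution: the Killing spinor of Kerr in Kerr–Schild Cartesian coordinates -/

namespace Kerr

/-- Components `(u ∧ v)_{μν} = u_μ v_ν − u_ν v_μ` of the wedge of two covectors given by their
components. [folklore] -/
def wedgeCoef (u v : Fin 4 → ℝ) (μ ν : Fin 4) : ℝ := u μ * v ν - u ν * v μ

/-- The wedge is antisymmetric. [folklore] -/
theorem wedgeCoef_antisymm (u v : Fin 4 → ℝ) (μ ν : Fin 4) :
    wedgeCoef u v μ ν = -wedgeCoef u v ν μ := by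
  unfold wedgeCoef; ring

/-- **The principal tensor of Kerr in Kerr–Schild Cartesian coordinates** (the non-degenerate
closed conformal Killing–Yano `2`-form `h = db`):
`h = dx⁰ ∧ (x₁ dx¹ + x₂ dx² + x₃ dx³) + a dx¹ ∧ dx²`, components `h_{μν}(x)`. Its components are
polynomial and do **not** involve the mass: the potential `b`, `h` and `f = ⋆h` have their
flat-space form in the canonical and in the Kerr–Schild-adapted coordinates, and the
Kerr–Schild Cartesian chart is built from the latter by a mass-independent map
(Frolov–Krtouš–Kubizňák, Living Rev. Relativ. 20 (2017) 6, §3.2.3 (Theorem: `h = db`,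
`b = −½[(r² − y²) dτ + r² y² dψ]`, `y = a cos θ`), the remark opening §3.2.4 (`b`, `h`, `f = ⋆h`
do not depend on the metric functions `Δ_r`, `Δ_y`, hence not on `M`), §3.6.1 eq. (hhhh) — the
displayed formula — and §3.7, eq. (KSchild4dmetric) ff.: "`l` is an eigenvector of the principal
tensor"). In the chart of `KerrSchild.lean` (ingoing,
`ℓ = Kerr.nullCovector a`, rotation parameter `a` as in `Kerr.nullCovectorFun`) the relative
sign of the two terms is fixed by the eigen-equation `h_{μν} ℓ^ν = r ℓ_μ`
(`principalCKYForm_nullVector`). For `M = 0` it is the flat principal tensor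
`dT ∧ (X dX + Y dY + Z dZ) + a dX ∧ dY`. Conformal Killing–Yano: `KillingSpinor.ckyOp` of
(the complexification of) `h` vanishes for `G = Kerr.bilin M a` on `{r > 0}`; divergence
`⅓ ∇^ν h_{νμ} ∝ (∂_{t*})_μ` (the primary Killing vector). [cite: FrolovKrtousKubiznak2017, §3.6.1 eq. (hhhh) and §3.7] -/
def principalCKYForm (a : ℝ) (x : E4) (μ ν : Fin 4) : ℝ :=
  wedgeCoef ![1, 0, 0, 0] ![0, x 1, x 2, x 3] μ ν + a * wedgeCoef ![0, 1, 0, 0] ![0, 0, 1, 0] μ ν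

/-- **The Killing–Yano tensor of Kerr in Kerr–Schild Cartesian coordinates**, the Hodge dual
`f = ⋆h` of the principal tensor for the chart orientation `dx⁰∧dx¹∧dx²∧dx³`
(`(⋆ω)_{ab} = ½ ε_{ab}{}^{cd} ω_{cd}`, `ε_{0123} = √|det g| = 1` for Kerr–Schild metrics, and
`⋆_g h = ⋆_η h` because `ℓ` is an eigen-covector of `h`):
`f = −(x₁ dx²∧dx³ + x₂ dx³∧dx¹ + x₃ dx¹∧dx²) + a dx⁰∧dx³`. For `a = 0` this is (minus) the
Penrose–Floyd tensor `r³ sin θ dθ ∧ dφ` of Schwarzschild. Frolov–Krtouš–Kubizňák (2017), §2.5.3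
(Hodge duals of closed conformal Killing–Yano forms are Killing–Yano), §3.3 (Kerr).
[cite: FrolovKrtousKubiznak2017, §3.6.1 and §2.5.3] -/
def principalKYForm (a : ℝ) (x : E4) (μ ν : Fin 4) : ℝ :=
  -(x 1 * wedgeCoef ![0, 0, 1, 0] ![0, 0, 0, 1] μ ν + x 2 * wedgeCoef ![0, 0, 0, 1] ![0, 1, 0, 0] μ ν
      + x 3 * wedgeCoef ![0, 1, 0, 0] ![0, 0, 1, 0] μ ν) +
    a * wedgeCoef ![1, 0, 0, 0] ![0, 0, 0, 1] μ ν

/-- **The Killing spinor of Kerr as a self-dual `2`-form in Kerr–Schild Cartesian coordinates**: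
`κ = h − i ⋆h` (`principalCKYForm − i · principalKYForm`), the self-dual part (`⋆κ = iκ` for the
chart orientation, `KillingSpinor.IsSelfDual`) of twice the principal tensor. This is the tensor
`κ_{AB} ε̄_{A'B'}` of the valence-`2` Killing spinor `κ_{AB} = ψ^{-1/3} o_{(A} ι_{B)}` of the type-D
vacuum Kerr spacetime (Walker–Penrose 1970; García-Parrado–Valiente Kroon (2008), App. A,
Prop. 7; Bäckdahl–Valiente Kroon (2010), §2.4), `ψ^{-1/3} ∝ r − i a cos θ` (`Ψ₂ ∝ (r − i a cos θ)⁻³`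
for Kerr; `cos θ = x₃ / r`, `Kerr.cosTheta`): the eigenvalues of `h` are `r` and `y = a cos θ`
(Frolov–Krtouš–Kubizňák (2017), §3.2.3–3.2.4), so `κ_{ab} κ^{ab} = −4 (r − i a cos θ)²`, and on the
positive rotation axis `κ = (x₃ − i a)(dx⁰∧dx³ + i dx¹∧dx²)` (`killingSpinorForm_axis`).
**Model solution**: for
`G = Kerr.bilin M a` on `Kerr.region a r₀` one has `KillingSpinor.ckyOp G κ = 0`,
`KillingSpinor.div G κ ∝ g(∂_{t*}, ·)` (so `KillingSpinor.killingDefect G κ = 0`, i.e.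
`KillingSpinorObstructionField G κ = 0`) and `KillingSpinor.propagationOp G κ = 0` — the
calibration of the sign conventions of this file (not asserted as Lean theorems).
[cite: WalkerPenrose1970] -/
def killingSpinorForm (a : ℝ) (x : E4) (μ ν : Fin 4) : ℂ :=
  (principalCKYForm a x μ ν : ℂ) - Complex.I * (principalKYForm a x μ ν : ℂ)

/-- The principal tensor is a `2`-form. [cite: FrolovKrtousKubiznak2017, §3.6.1] -/
theorem principalCKYForm_antisymm (a : ℝ) (x : E4) (μ ν : Fin 4) :
    principalCKYForm a x μ ν = -principalCKYForm a x ν μ := by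
  unfold principalCKYForm
  rw [wedgeCoef_antisymm ![1, 0, 0, 0], wedgeCoef_antisymm ![0, 1, 0, 0]]
  ring

/-- The Killing–Yano tensor is a `2`-form. [cite: FrolovKrtousKubiznak2017, §2.5.3] -/
theorem principalKYForm_antisymm (a : ℝ) (x : E4) (μ ν : Fin 4) :
    principalKYForm a x μ ν = -principalKYForm a x ν μ := by
  unfold principalKYForm
  rw [wedgeCoef_antisymm ![0, 0, 1, 0], wedgeCoef_antisymm ![0, 0, 0, 1],
    wedgeCoef_antisymm ![0, 1, 0, 0], wedgeCoef_antisymm ![1, 0, 0, 0]]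
  ring

/-- The Kerr Killing-spinor `2`-form is a `2`-form (`KillingSpinor.IsTwoForm`). [cite: WalkerPenrose1970] -/
theorem isTwoForm_killingSpinorForm (a : ℝ) : KillingSpinor.IsTwoForm (killingSpinorForm a) := by
  intro x μ ν
  unfold killingSpinorForm
  rw [principalCKYForm_antisymm a x μ ν, principalKYForm_antisymm a x μ ν]
  push_cast
  ring

/-- **The Kerr–Schild null vector is an eigenvector of the principal tensor with eigenvalue `r`**:
`Σ_ν h_{μν} ℓ^ν = r ℓ_μ` wherever `r > 0` (`ℓ^ν = Kerr.nullVector`, `ℓ_μ = Kerr.nullCovectorFun`),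
by the defining quartic of the Kerr–Schild radius. This identity fixes the relative sign of the
two terms of `principalCKYForm` in the chart of `KerrSchild.lean`. Frolov–Krtouš–Kubizňák (2017),
§3.7: "the vector `l` is an eigenvector of the principal tensor; at the same time it is a
principal null direction". [cite: FrolovKrtousKubiznak2017, §3.7] -/
theorem principalCKYForm_nullVector {a : ℝ} {x : E4} (hx : 0 < radius a x) (μ : Fin 4) :
    ∑ ν, principalCKYForm a x μ ν * nullVector a x ν = radius a x * nullCovectorFun a x μ := by
  have hq := radius_quartic a x
  rw [E4.spatialNorm_sq] at hq
  have h1 : radius a x ^ 2 + a ^ 2 ≠ 0 := by positivity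
  have h2 : radius a x ≠ 0 := hx.ne'
  fin_cases μ
  · simp [principalCKYForm, wedgeCoef, nullVector, nullCovectorFun, Fin.sum_univ_four]
    field_simp
    linear_combination -hq
  · simp [principalCKYForm, wedgeCoef, nullVector, nullCovectorFun, Fin.sum_univ_four]
    field_simp
    ring
  · simp [principalCKYForm, wedgeCoef, nullVector, nullCovectorFun, Fin.sum_univ_four]
    field_simp
    ring
  · simp [principalCKYForm, wedgeCoef, nullVector, nullCovectorFun, Fin.sum_univ_four]
    field_simp

/-- Components of the model forms in the `(x⁰, x³)` and `(x¹, x²)` planes: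
`h_{03} = x₃`, `f_{03} = a`, `h_{12} = a`, `f_{12} = −x₃`. [cite: FrolovKrtousKubiznak2017, §3.6.1] -/
theorem principalForms_apply (a : ℝ) (x : E4) :
    principalCKYForm a x 0 3 = x 3 ∧ principalKYForm a x 0 3 = a ∧
      principalCKYForm a x 1 2 = a ∧ principalKYForm a x 1 2 = -x 3 := by
  simp [principalCKYForm, principalKYForm, wedgeCoef]

/-- On the rotation axis `{x₁ = x₂ = 0}` the Kerr Killing-spinor form is
`(x₃ − i a)(dx⁰ ∧ dx³ + i dx¹ ∧ dx²)`: `κ_{03} = x₃ − i a`, `κ_{12} = i (x₃ − i a)` — the factor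
`r − i a cos θ` of `ψ^{-1/3}` on the positive axis (`r = |x₃|`, `cos θ = x₃/r` there).
Walker–Penrose 1970; Bäckdahl–Valiente Kroon 2010, §3. [cite: WalkerPenrose1970] -/
theorem killingSpinorForm_axis (a : ℝ) (x : E4) :
    killingSpinorForm a x 0 3 = (x 3 : ℂ) - Complex.I * a ∧
      killingSpinorForm a x 1 2 = Complex.I * ((x 3 : ℂ) - Complex.I * a) := by
  obtain ⟨h03, f03, h12, f12⟩ := principalForms_apply a x
  refine ⟨by rw [killingSpinorForm, h03, f03], ?_⟩
  rw [killingSpinorForm, h12, f12]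
  push_cast
  linear_combination (a : ℂ) * Complex.I_mul_I

end Kerr

end Literature.Geometry.Lorentzian

end
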